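import Summits.Ventures.QEC.CircuitDistance.ETowerDefs
import Summits.Ventures.QEC.CircuitDistance.ETowerDataX
import HarnessLib

/-!
# E-fold tower — the nested node checks, sector X (STEP 2 of R152 (2), CARD-7; node K)

Over the TREE's `ETowerDefs` (type-1 g2, p680896: `nodeK`/`nodeKW` normalise the support list first) and `ETowerDataX`.
Names and bodies as in idea-1's prototype `etlean/ETowerKX.lean` = the shapes of type-1's STEP2-ASSEMBLY-SPEC §B6 (`ktop` is `ktopG …` and
`nodeC` is `nodeGdG …` by `rfl`, ETowerTop). Emitted by qec-cdx-eng-1 g2. No `native_decide`.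
-/

set_option maxRecDepth 100000

namespace Summit.Ventures.QEC.CircuitDistance.ETower.SecX

open Summit.Ventures.QEC.Census Summit.Ventures.QEC.Census.Fold Summit.Ventures.QEC.CircuitDistance.ETower

/-- level-A big geometry `(6,3)`, fold axis x. -/
def GA : Geo := ⟨6, 3, true⟩
/-- level-B big geometry `(6,6)`, fold axis y. -/
def GB : Geo := ⟨6, 6, false⟩
/-- level-C big geometry `(12,6)`, fold axis x. -/
def GC : Geo := ⟨12, 6, true⟩

/-- top continuation on a 360-word: logical parities all zero (trivial class), or an anchored translate is a listed K2 class. -/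
noncomputable def ktop (S : List ℕ) : Bool :=
  (xorIdx (fun j => tab TLG 12 j) S == 0) || (matchRep 12 6 md0 (repStore md0 TOPS) false S).isSome
/-- level C node on a 180-word of `E(6,6)`: words of weight `≤ 3` are referred to the separately certified classes `W3C`. -/
noncomputable def nodeC (S : List ℕ) : Bool :=
  (S.length ≤ 3 && (matchRep 6 6 md0 (repStore md0 W3C) false S).isSome) || nodeK GC 180 (tab TFC 72) (tab TPC 72) 9 ktop S
/-- one window of the level-C fibre over a `W3C` word. -/
noncomputable def nodeCW (S : List ℕ) (w : ℕ × ℕ) : Bool := nodeKW GC 180 (tab TFC 72) (tab TPC 72) 9 ktop S w.1 w.2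
/-- level B node on a 90-word of `E(6,3)`. -/
noncomputable def nodeB (S : List ℕ) : Bool := nodeK GB 90 (tab TFB 42) (tab TPB 42) 9 nodeC S
/-- level A node on a 45-word of `E(3,3)` (a base unit). -/
noncomputable def nodeA (S : List ℕ) : Bool := nodeK GA 45 (tab TFA 24) (tab TPA 24) 9 nodeB S

end Summit.Ventures.QEC.CircuitDistance.ETower.SecX
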